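import Literature.AlgebraicGeometry.Resolution.BlowupTwistEvaluation
import Literature.AlgebraicGeometry.Resolution.MarkedIdealsLemmas
import Literature.AlgebraicGeometry.Modules.IdealMulRestrictOpen
import Literature.AlgebraicGeometry.Modules.SerreVanishingTwist
import Literature.AlgebraicGeometry.Modules.SerreTheoremA
import Literature.AlgebraicGeometry.Modules.RestrictOpenCoh
import Literature.AlgebraicGeometry.Morphisms.CechModuleRestrictOpen
import Literature.AlgebraicGeometry.Morphisms.CechModuleH2MorphismTransfer
import HarnessLib

/-!
# Local Serre vanishing on a blowing up: `H¹(r⁻¹U, 𝓙ⁿ·G) = 0` for `n ≫ 0` over an affine open `U`,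
# for coherent `G` without `𝓙`-torsion (`𝓙 = J·𝒪` the exceptional ideal)

Topic: `Literature/AlgebraicGeometry/Resolution`. PROVED, fact-free, definition-free. Step S6-LOCAL (LV-tf) of
the F-53 route (δ) «domination + divisorial twist» (D-0154 (2) RES inputs cell; lead res-inputs-p-9b, this file
res-inputs-p-9c; binders frozen by the lead 2026-08-28): the local cohomological input consumed by the lead's
global step S6/S7 towards `NoZeno.GWH2ResolutionDim2`.

THE MATHEMATICS (Hartshorne III Thm. 5.2 (b), II Prop. 7.13 (a); Liu Prop. 8.1.12; Stacks 01ED, 02OS). Let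
`r : S′ → X` be the blowing up of a locally Noetherian scheme `X` along an ideal sheaf `J` (tree `IsBlowup`),
`𝓙 = J·𝒪_{S′} = J.comap r` the exceptional ideal, `U = Spec B ⊆ X` an affine open, `fS : S′ → Spec A` any
structure map, and `G` a coherent `𝒪_{S′}`-module with no non-zero section over an affine open killed by `𝓙`.
Choose generators `c₀, …, c_m` of `J(U)`. Then `r⁻¹U ≅ Z := Bl_{J(U)}(Spec B)` by an open immersion
`φ : Z → S′` with `𝓙|_Z` the exceptional ideal of `Z` (tree `IsBlowup.exists_chartImmersion_span`), and `Z`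
is Rees-embedded, `ι = reesEmbedding c : Z ↪ 𝐏ᵐ_B`, a closed immersion with standard charts
`Z_j = D₊(c_j t)`. By Serre's theorems on `Z ↪ 𝐏ᵐ_B` (tree `SerreTheoremA.exists_generators`,
`exists_forall_subsingleton_cechMH1_twistMod`) `Ȟ¹((Z_j)_j; G|_Z(n)) = 0` for `n ≥ d₀`; since `G|_Z` is
coherent and exceptional-torsion-free, `G|_Z(n) ≅ 𝓙|_Zⁿ·G|_Z` (`isIso_twistEvalLift`, the chart dictionary
`𝒪(1) = J𝒪`), and `𝓙|_Zⁿ·G|_Z = (𝓙ⁿ·G)|_Z` (`nonempty_restrict_idealMul_iso`); transporting along `φ`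
(`cechMZ1_le_cechMB1_image_of_subsingleton_restrict`) gives: **every Čech `1`-cocycle of `𝓙ⁿ·G` on the
finite affine open cover `(φ Z_j)_j` of `r⁻¹U` is a coboundary, for all `n ≥ d₀`** — i.e.
`H¹(r⁻¹U, 𝓙ⁿG) = 0` for `n ≫ 0` (`r⁻¹U` is separated over the affine `U`, so Čech computes `H¹`; that
translation is not needed by the consumer and not made here).

## Main statement

* `exists_affine_family_cechMZ1_idealMul_pow_le_of_torsionFree` — in the lead's frozen binders:
  `∃ d₀, ∀ n ≥ d₀, ∃ (κ : Type u) (T : κ → S′.Opens), (∀ t, IsAffineOpen (T t)) ∧ ⨆ t, T t = r ⁻¹ᵁ U ∧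
   cechMZ1 fS (idealMul G ((J.comap r) ^ n)) T ≤ cechMB1 fS (idealMul G ((J.comap r) ^ n)) T`.

Nothing of `GortzWedhorn2023_24_44_H2` (general) or of the F-53 door `GWH2ProperBirationalDim2` is discharged
by this file alone; they stay PRINT. AI-written; AI review is weaker than expert review.

## References
* R. Hartshorne, *Algebraic Geometry*, GTM 52 (1977), III Thm. 5.2 (b) (p. 228: `Hⁱ(F(n)) = 0`, `n ≫ 0`),
  II Prop. 7.13 (a) and its proof (`π⁻¹𝓘·𝒪_X̃ = 𝒪(1)`), III Lemma 4.4 / Thm. 4.5. [Hartshorne1977]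
* Q. Liu, *Algebraic Geometry and Arithmetic Curves* (2002), Prop. 8.1.12 (p. 380). [Liu2002]
* The Stacks Project, Tags 01ED (Čech cohomology and pushforward), 0804, 02OS (charts of the blowing up).
  [StacksProject]
-/

noncomputable section

universe u

open CategoryTheory AlgebraicGeometry TopologicalSpace Opposite
open Literature.AlgebraicGeometry.Morphisms Literature.AlgebraicGeometry.Morphisms.ProjCech
open Literature.AlgebraicGeometry.Modules Literature.AlgebraicGeometry.Modules.SerreTwist

namespace Literature.AlgebraicGeometry.Resolution

/-- **LOCAL SERRE VANISHING ON A BLOWING UP (LV-tf), route (δ) step S6-LOCAL.** Let `r : S′ → X` be the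
blowing up along `J` (`𝓙 := J·𝒪_{S′} = J.comap r`), `X` locally Noetherian, `U ⊆ X` an affine open,
`fS : S′ → Spec A` any structure map, and `G` a COHERENT `𝒪_{S′}`-module with no non-zero section over an
affine open killed by `𝓙`. Then there is `d₀` such that for every `n ≥ d₀` some finite affine open cover `𝒯`
of `r⁻¹U` — the images of the standard charts `D₊(c_j t)` of `r⁻¹U ≅ Bl_{J(U)}(Spec Γ(X,U)) ↪ 𝐏ᵐ_{Γ(X,U)}`
— has every Čech `1`-cocycle of `𝓙ⁿ·G` a coboundary: `H¹(r⁻¹U, 𝓙ⁿG) = 0` for `n ≫ 0`. Proof: Serre's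
theorems A and `Ȟ¹(G(n)) = 0` on the Rees-embedded `Bl_{J(U)}(Spec Γ(X,U))`, the isomorphism
`G(n) ≅ 𝓙ⁿ·G` there (`𝒪(1) = 𝓙`, `G` is `𝓙`-torsion-free), `(𝓙ⁿG)|_Z ≅ 𝓙|_Zⁿ·G|_Z`, and Čech transport
along the open immersion onto `r⁻¹U`.
[cite: Hartshorne1977, III Thm. 5.2 (b) p. 228] [cite: Hartshorne1977, II Prop. 7.13 (a) and proof] -/
theorem exists_affine_family_cechMZ1_idealMul_pow_le_of_torsionFree
    {A : Type u} [CommRing A] {X S' : Scheme.{u}} [IsLocallyNoetherian X]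
    (fS : S' ⟶ Spec (.of A)) (r : S' ⟶ X) (J : X.IdealSheafData) (hr : IsBlowup r J)
    (U : X.Opens) (hU : IsAffineOpen U) (G : S'.Modules) (hG : Coh G)
    (htf : ∀ (V : S'.Opens) (hV : IsAffineOpen V) (q : Γ(G, V)),
      (∀ a ∈ (J.comap r).ideal ⟨V, hV⟩, a • q = 0) → q = 0) :
    ∃ d₀ : ℕ, ∀ n, d₀ ≤ n → ∃ (κ : Type u) (T : κ → S'.Opens), (∀ t, IsAffineOpen (T t)) ∧
      ⨆ t, T t = r ⁻¹ᵁ U ∧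
      cechMZ1 fS (idealMul G ((J.comap r) ^ n)) T ≤ cechMB1 fS (idealMul G ((J.comap r) ^ n)) T := by
  classical
  let U' : X.affineOpens := ⟨U, hU⟩
  haveI : IsNoetherianRing Γ(X, U) := IsLocallyNoetherian.component_noetherian U'
  -- generators `c₀, …, c_m` of `J(U)` (padded with `0` so that the index type is `Fin (m + 1)`)
  obtain ⟨m, c, hc⟩ : ∃ (m : ℕ) (c : Fin (m + 1) → Γ(X, U)), Ideal.span (Set.range c) = J.ideal U' := by
    obtain ⟨k, b, hb⟩ :=
      Submodule.fg_iff_exists_fin_generating_family.mp (IsNoetherian.noetherian (J.ideal U'))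
    refine ⟨k, Fin.cons 0 b, ?_⟩
    rw [Fin.range_cons, Ideal.span_insert, Ideal.span_singleton_eq_bot.mpr rfl, bot_sup_eq]
    exact hb
  -- the open immersion `φ : Z = Bl_{(c)}(Spec Γ(X,U)) → S′` onto `r⁻¹U`, `𝓙|_Z` = the exceptional ideal
  obtain ⟨φ, hφ, -, hrange, hexc⟩ := hr.exists_chartImmersion_span U' c hc
  -- Serre A + Serre vanishing for `G|_Z` on the Rees-embedded blowing up
  set ι₀ := reesEmbedding c with hι₀
  have hGZ : Coh (G.restrict φ) := coh_restrict φ G hG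
  obtain ⟨mA, hA⟩ := exists_generators ι₀ (G.restrict φ) hGZ
  obtain ⟨N₀, g₀, hgen₀⟩ := hA mA le_rfl
  obtain ⟨d₁, hd₁⟩ := exists_forall_subsingleton_cechMH1_twistMod ι₀ (G.restrict φ) mA g₀ hGZ.loc hgen₀
  refine ⟨d₁, fun n hn => ?_⟩
  -- `G|_Z` has no torsion for the exceptional ideal `= 𝓙|_Z`
  have htfZ : ∀ (V : (affineBlowup (Ideal.span (Set.range c))).Opens) (hV : IsAffineOpen V)
      (q : Γ(G.restrict φ, V)),
      (∀ a ∈ (affineBlowup.exceptionalIdeal (Ideal.span (Set.range c))).ideal ⟨V, hV⟩, a • q = 0) →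
        q = 0 := by
    intro V hV q hq
    refine torsionFree_restrict φ G (J.comap r) htf V hV q ?_
    rw [hexc]
    exact hq
  -- `Ȟ¹ = 0` on the standard charts for `𝓙|_Zⁿ · G|_Z`, then for `(𝓙ⁿ·G)|_Z`
  have h2 := subsingleton_cechMH1_idealMul_pow_of_twistMod (G := G.restrict φ) (n := n) hGZ.loc htfZ
    (strZ ι₀) (cover ι₀) (hd₁ n hn)
  have hK : ((J.comap r) ^ n).comap φ = affineBlowup.exceptionalIdeal (Ideal.span (Set.range c)) ^ n := by
    rw [comap_pow, hexc]
  obtain ⟨e⟩ := nonempty_restrict_idealMul_iso φ G ((J.comap r) ^ n)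
  have h3 : Subsingleton (CechMH1 (strZ ι₀) ((idealMul G ((J.comap r) ^ n)).restrict φ) (cover ι₀)) := by
    refine subsingleton_cechMH1_of_iso (strZ ι₀) (cover ι₀) e ?_
    rw [hK]
    exact h2
  -- transport to `S′` along `φ`: the family `(φ Z_j)_j`
  have h6 := cechMZ1_le_cechMB1_image_of_subsingleton_restrict φ fS (strZ ι₀)
    (idealMul G ((J.comap r) ^ n)) (cover ι₀) h3
  have hTaff : ∀ j, IsAffineOpen (φ ''ᵁ cover ι₀ j) := fun j =>
    (isAffineOpen_Zop ι₀ (Finset.singleton_nonempty j)).image_of_isOpenImmersion φ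
  have hTcov : ⨆ j, φ ''ᵁ cover ι₀ j = r ⁻¹ᵁ U := by
    rw [← Scheme.Hom.image_iSup, ← hrange, ← Scheme.Hom.image_top_eq_opensRange]
    congr 1
    exact top_le_iff.mp ((le_iSup_inf_Zop ι₀ ⊤).trans (iSup_mono fun j => inf_le_right))
  -- reindex by `ULift` (universe of the index type) through cover independence in degree one
  have hNaff : IsAffineLocalizing (idealMul G ((J.comap r) ^ n)) := isAffineLocalizing_idealMul hG.loc
  refine ⟨ULift.{u} (Fin (m + 1)), fun k => φ ''ᵁ cover ι₀ k.down, fun k => hTaff k.down, ?_, ?_⟩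
  · rw [← hTcov]
    exact (Equiv.ulift.{u, 0} (α := Fin (m + 1))).iSup_congr fun _ => rfl
  · refine cechMZ1_le_cechMB1_of_iSup_eq fS hNaff (fun j => φ ''ᵁ cover ι₀ j) _ hTaff ?_ h6
    exact ((Equiv.ulift.{u, 0} (α := Fin (m + 1))).iSup_congr fun _ => rfl).symm

end Literature.AlgebraicGeometry.Resolution

end
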